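import Summits.QuantumAdvantage.QuantumAdvantage.Theorems.LinnikCubicClassGroupsDegreeOnePrimesEscapeDedekindRelation
import Literature.NumberTheory.LFunctions.DedekindZetaEntireConvexity
import Literature.NumberTheory.LFunctions.DedekindZetaThetaProofs
import Literature.NumberTheory.LFunctions.LevinsonMontgomery
import Mathlib.Analysis.Normed.Module.Connected
import HarnessLib

/-!
# A real zero of `ζ_k` is a zero of `ζ_N` for the quadratic resolvent `k` of an `S₃`-sextic `N`

Topic `Summits/QuantumAdvantage/QuantumAdvantage/Theorems`, cell B2b-1 (linnik-cubic), PART A (gen 7);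
helper toward the crux `DegreeOnePrimesEscape` (stmt-QuantumAdvantage-11543) of route
`LinnikCubicClassGroups`.  HONEST FRAMING: the value of this file is a THEOREM — NOT summit progress.

Dedekind's relation `ζ_N ζ² = ζ_k ζ_K²` (`stub_dedekindRelation`, on `Re s > 1` for the Dirichlet
series) continues to `ℂ ∖ {1}` for the analytic continuations (`dedekindZetaCont`, Mathlib's
`riemannZeta`) by the identity theorem on the connected open set `ℂ ∖ {1}`
(`dedekindZetaCont_sextic_relation`).  Since `ζ(σ) ≠ 0` for `0 < σ < 1`
(`riemannZeta_ne_zero_of_mem_Ioo_holds`), a real zero `β ∈ (0, 1)` of `ζ_k` is a zero of `ζ_N`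
(`dedekindZeta₁_eq_zero_of_resolvent`, stated for the entire functions `ζ₁ = (s − 1)ζ`).  This is how the
possible exceptional (Landau–Siegel) zero of the quadratic resolvent of a cubic field enters the sextic
closure, without Artin `L`-functions or the Aramata–Brauer theorem.
-/

noncomputable section

open Complex Real Set Filter Topology
open scoped NumberField nonZeroDivisors

namespace Summit.QuantumAdvantage.QuantumAdvantage.Theorems.DegreeOnePrimesEscape

open Literature.NumberTheory.LFunctions Literature.NumberTheory.LFunctions.NumberField

/-- **Dedekind's relation for the continuations**: for an `S₃`-sextic `N` with cubic subfield `K` and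
quadratic subfield `k`, `ζ_N(s) ζ(s)² = ζ_k(s) ζ_K(s)²` for all `s ≠ 1`. -/
theorem dedekindZetaCont_sextic_relation (N : Type) [Field N] [NumberField N] [IsGalois ℚ N]
    (h6 : Module.finrank ℚ N = 6) (hna : ∃ g h : N ≃ₐ[ℚ] N, g * h ≠ h * g)
    (K k : IntermediateField ℚ N) (hK : Module.finrank ℚ K = 3) (hk : Module.finrank ℚ k = 2)
    {s : ℂ} (hs : s ≠ 1) :
    dedekindZetaCont N s * riemannZeta s ^ 2 = dedekindZetaCont k s * dedekindZetaCont K s ^ 2 := by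
  have hN := isDedekindZetaContinuation_dedekindZetaCont_holds N
  have hK' := isDedekindZetaContinuation_dedekindZetaCont_holds K
  have hk' := isDedekindZetaContinuation_dedekindZetaCont_holds k
  set f : ℂ → ℂ := fun s ↦ dedekindZetaCont N s * riemannZeta s ^ 2 with hf
  set g : ℂ → ℂ := fun s ↦ dedekindZetaCont k s * dedekindZetaCont K s ^ 2 with hg
  have hfd : DifferentiableOn ℂ f {1}ᶜ := hN.differentiableOn.mul (differentiableOn_riemannZeta.pow 2)
  have hgd : DifferentiableOn ℂ g {1}ᶜ := hk'.differentiableOn.mul (hK'.differentiableOn.pow 2)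
  have hpc : IsPreconnected ({1}ᶜ : Set ℂ) :=
    (isConnected_compl_singleton_of_one_lt_rank (rank_real_complex ▸ Nat.one_lt_ofNat) _)
      |>.isPreconnected
  have hne : (2 : ℂ) ∈ ({1}ᶜ : Set ℂ) := by simp
  have heq : f =ᶠ[𝓝 2] g := by
    refine eventually_of_mem
      ((continuous_re.isOpen_preimage _ isOpen_Ioi).mem_nhds (by simp : 1 < (2 : ℂ).re))
      (fun t (ht : 1 < t.re) ↦ ?_)
    simp only [hf, hg]
    rw [hN.eqOn ht, hK'.eqOn ht, hk'.eqOn ht]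
    exact stub_dedekindRelation N h6 hna K k hK hk t ht
  exact (AnalyticOnNhd.eqOn_of_preconnected_of_eventuallyEq
    (hfd.analyticOnNhd isOpen_compl_singleton) (hgd.analyticOnNhd isOpen_compl_singleton) hpc hne heq) hs

/-- **A real zero of the resolvent zeta function is a zero of the sextic zeta function**: with `N, K, k`
as above and `0 < β < 1`, `ζ₁_k(β) = 0` implies `ζ₁_N(β) = 0` (`ζ₁ = (s − 1)ζ`; `ζ(β) ≠ 0`). -/
theorem dedekindZeta₁_eq_zero_of_resolvent (N : Type) [Field N] [NumberField N] [IsGalois ℚ N]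
    (h6 : Module.finrank ℚ N = 6) (hna : ∃ g h : N ≃ₐ[ℚ] N, g * h ≠ h * g)
    (K k : IntermediateField ℚ N) (hK : Module.finrank ℚ K = 3) (hk : Module.finrank ℚ k = 2)
    {β : ℝ} (hβ0 : 0 < β) (hβ1 : β < 1) (hzero : dedekindZeta₁ k β = 0) :
    dedekindZeta₁ N β = 0 := by
  have hβne : (β : ℂ) ≠ 1 := by
    intro h; have := congrArg Complex.re h; simp at this; linarith
  have hsub : (β : ℂ) - 1 ≠ 0 := sub_ne_zero.mpr hβne
  rw [dedekindZeta₁_apply_of_ne_one hβne] at hzero ⊢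
  have hk0 : dedekindZetaCont k β = 0 := by
    rcases mul_eq_zero.mp hzero with h | h
    · exact absurd h hsub
    · exact h
  have hrel := dedekindZetaCont_sextic_relation N h6 hna K k hK hk hβne
  rw [hk0, zero_mul] at hrel
  have hζ : riemannZeta (β : ℂ) ≠ 0 := riemannZeta_ne_zero_of_mem_Ioo_holds β hβ0 hβ1
  rcases mul_eq_zero.mp hrel with h | h
  · rw [h, mul_zero]
  · exact absurd (pow_eq_zero_iff (by norm_num) |>.mp h) hζ

end Summit.QuantumAdvantage.QuantumAdvantage.Theorems.DegreeOnePrimesEscape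

end
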